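import Summits.ResolutionOfSingularities.ResolutionOfSingularities.Theorems.MarkedTransferCampaignW46LooseExitTreeFinite
import Summits.ResolutionOfSingularities.ResolutionOfSingularities.Theorems.MarkedTransferCampaignW46LooseExitTreeGerm
import Summits.ResolutionOfSingularities.ResolutionOfSingularities.Theorems.MarkedTransferCampaignW46LooseExitTreeNormalForm
import Summits.ResolutionOfSingularities.ResolutionOfSingularities.Theorems.MarkedTransferCampaignW46FiniteExitBoundHolds
import Summits.ResolutionOfSingularities.ResolutionOfSingularities.Theorems.MarkedTransferCampaignW46FiniteExitBoundGlue
import HarnessLib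

/-!
# [OURS · L1 W4.6 rung (i-b)] The per-point measure of rung (i-b) and its ONE-STEP LAWS AT A POINT BLOW-UP: the fibre sum
# drops over a non-procrastinating centre, nothing changes off the centre
# (cell res-hironaka, LADDER-RESOLUTION rung L, D-0089; campaign s46, prover res-L1-s46-pv-1; host route MarkedTransfer,
# `--supports stmt-ResolutionOfSingularities-16155`)

HONEST FRAMING. Nothing here is a statement of H. Hironaka's manuscript (2017-03-23, [Hironaka2017]); OURS bookkeeping
joining this seat's loose exit tree / normal form (`…LooseExitTree*.lean`, `…AdmissibleDivision.lean`) to res-L1-s46-pv-9's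
scheme dictionary (`…FiniteExitBoundNodes/Glue/Holds.lean`: stalks read in `K(Z)`, the ideal identity, injectivity of the
points over the centre, N-1 stalks over `K : Type`). AI-written; weaker than expert review. No `sorry`; axioms standard.

## Contents

* `looseGermMeasure R I b := ν̃(R, normalForm b I, b)` — the per-point measure `μ(A, E, y) = ν̃(𝒪_y, NF(J_y), b)`;
  `looseGermMeasure_map_ringEquiv`.
* `stalkIdeal_not_le_prime_pow_of_nonProcrastinating` — ISOLATION of the germ at a closed point `ξ` to which no other point
  of `Sing(E)` specialises; `isIsolatedNode_range_of_nonProcrastinating` — the root node is an isolated node (`K : Type`).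
* **`looseGermMeasure_centre_lt`** — at the blow-up of such a point `ξ` with `dim 𝒪_{Z,ξ} = 2`: for every finset `t` of
  points over `ξ`, `Σ_{ξ′ ∈ t} μ(A′, E′, ξ′) < μ(A, E, ξ)` (centre inequality of the loose tree + the normal form of the
  controlled transform is the loose transform).
* `looseGermMeasure_offCentre_eq` — off the centre `μ(A′, E′, ξ′) = μ(A, E, π ξ′)`.
* `looseExitCount_eq_zero_of_ringKrullDim_ne_two` — nodes of dimension `≠ 2` have empty loose tree.

## References

* O. Zariski, P. Samuel, *Commutative Algebra* II (1960), Appendix 5. [ZariskiSamuel1960]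
* res-L1-s46-pv-9 (res-D-pv-046), `Theorems/MarkedTransferCampaignW46FiniteExitBound*.lean`.
-/

noncomputable section

set_option linter.dupNamespace false -- mandated namespace of this single-conjunct summit

open CategoryTheory AlgebraicGeometry TopologicalSpace IsLocalRing

namespace Summit.ResolutionOfSingularities.ResolutionOfSingularities.Theorems

namespace CampaignW46

open Literature.AlgebraicGeometry.Resolution
open Literature.AlgebraicGeometry.Hironaka2017.S02Preliminaries
open Scheme.IdealSheafData

universe u

/-! ## The per-point measure -/

open Classical in
/-- [OURS · L1 W4.6 rung (i-b)] NOT a statement of the manuscript. **The per-point measure of rung (i-b)** as a function of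
(local ring, ideal, exponent): the loose exit count of the NORMAL FORM of the ideal, `ν̃(R, normalForm b I, b)` (junk `0`
for a non-local ring). At a closed point `y` of a surface state: the number of nodes of the loose exit tree above
`(𝒪_y, NF(J_y))`, where `NF` divides out the regular curves of the singular locus through `y` as often as forced. [folklore] -/
def looseGermMeasure (R : Type u) [CommRing R] (I : Ideal R) (b : ℕ) : ℕ :=
  if h : IsLocalRing R then germLooseExitCount R (@normalForm R _ h b I) b else 0

/-- The local branch. [folklore] -/
theorem looseGermMeasure_eq {R : Type u} [CommRing R] [h : IsLocalRing R] (I : Ideal R) (b : ℕ) :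
    looseGermMeasure R I b = germLooseExitCount R (normalForm b I) b := by
  rw [looseGermMeasure, dif_pos h]

/-- **The per-point measure is invariant under ring isomorphisms.** [folklore] -/
theorem looseGermMeasure_map_ringEquiv (R S : Type u) [CommRing R] [CommRing S] (e : R ≃+* S) (I : Ideal R) (b : ℕ) :
    looseGermMeasure S (I.map e) b = looseGermMeasure R I b := by
  by_cases h : IsLocalRing R
  · haveI := h
    haveI : IsLocalRing S := e.isLocalRing
    rw [looseGermMeasure_eq, looseGermMeasure_eq, show I.map e = I.map (e : R →+* S) from rfl, ← map_normalForm e I,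
      show (normalForm b I).map (e : R →+* S) = (normalForm b I).map e from rfl, germLooseExitCount_map_ringEquiv]
  · have h' : ¬ IsLocalRing S := fun hS => h (by haveI := hS; exact e.symm.isLocalRing)
    rw [looseGermMeasure, looseGermMeasure, dif_neg h, dif_neg h']

/-- Nodes whose ring is not two-dimensional have empty loose tree, hence loose exit count `0`. [folklore] -/
theorem looseExitCount_eq_zero_of_ringKrullDim_ne_two {K : Type u} [Field K] {b : ℕ} {S : Subring K} (J : Ideal S)
    (h : ringKrullDim S ≠ 2) : looseExitCount b S J = 0 := by
  have hns : ¬ IsSingularNode b (⟨S, J⟩ : MarkedNode K) := fun ⟨_, hd, _, _⟩ => h hd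
  have hni : ¬ IsIsolatedNode b (⟨S, J⟩ : MarkedNode K) := fun hi => hns hi.isSingularNode
  rw [looseExitCount, Set.ncard_eq_zero (finite_looseExitTree b _)]
  ext n
  simp only [Set.mem_empty_iff_false, iff_false]
  intro hn
  have := looseExitTree_subset_singleton_of_not_isIsolatedNode hni hn
  rw [Set.mem_singleton_iff] at this
  subst this
  exact hns hn.2

/-! ## Isolation of the germ at a non-procrastinating point -/

/-- **ISOLATION of the germ at a point to which no other singular point specialises.** For every point `ξ` such that
every `η ∈ Sing(E)` with `η ⤳ ξ` equals `ξ`, and every non-maximal prime `𝔮` of `𝒪_{Z,ξ}`: `J_ξ ⊄ 𝔮^b` (the prime is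
that of a generization `η ≠ ξ`, which would lie in `Sing(E)`). [cite: StacksProject, Tag 01J7] -/
theorem stalkIdeal_not_le_prime_pow_of_nonProcrastinating {Z : Scheme.{u}} (E : IdealExponent Z) (ξ : Z)
    (hnp : ∀ η ∈ E.sing, η ⤳ ξ → η = ξ) (𝔮 : Ideal (Z.presheaf.stalk ξ)) [𝔮.IsPrime]
    (h𝔮 : 𝔮 ≠ maximalIdeal (Z.presheaf.stalk ξ)) : ¬ stalkIdeal E.J ξ ≤ 𝔮 ^ E.b := by
  intro hle
  obtain ⟨η, hηξ, h𝔮eq⟩ := exists_specializes_comap_stalkSpecializes_eq ξ 𝔮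
  letI := (Z.presheaf.stalkSpecializes hηξ).hom.toAlgebra
  haveI hloc := isLocalizationAtPrime_stalkSpecializes (X := Z) hηξ
  have hJη : stalkIdeal E.J η ≤ maximalIdeal (Z.presheaf.stalk η) ^ E.b := by
    rw [← stalkIdeal_map_stalkSpecializes E.J hηξ]
    have h1 : (stalkIdeal E.J ξ).map (Z.presheaf.stalkSpecializes hηξ).hom ≤
        (𝔮 ^ E.b).map (Z.presheaf.stalkSpecializes hηξ).hom := Ideal.map_mono hle
    refine h1.trans ?_
    rw [Ideal.map_pow]
    refine Ideal.pow_right_mono ?_ E.b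
    have hmap : 𝔮.map (algebraMap (Z.presheaf.stalk ξ) (Z.presheaf.stalk η)) =
        maximalIdeal (Z.presheaf.stalk η) := by
      rw [h𝔮eq]
      exact IsLocalization.AtPrime.map_eq_maximalIdeal
        ((maximalIdeal (Z.presheaf.stalk η)).comap (Z.presheaf.stalkSpecializes hηξ).hom) (Z.presheaf.stalk η)
    rw [RingHom.algebraMap_toAlgebra] at hmap
    exact hmap.le
  have hηS : η ∈ E.sing := (le_idealOrder_iff E.J η E.b).mpr hJη
  have hξη : η = ξ := hnp η hηS hηξ
  subst hξη
  apply h𝔮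
  rw [h𝔮eq]
  have hid : Z.presheaf.stalkSpecializes hηξ = 𝟙 _ := TopCat.Presheaf.stalkSpecializes_refl _ _
  rw [hid]
  exact Ideal.comap_id _

variable {p : ℕ} [Fact p.Prime]

/-- In prime-element form: at a non-procrastinating point of a SURFACE germ (`dim 𝒪_{Z,ξ} = 2`), `J_ξ ⊄ (a^b)` for every
prime element `a` of `𝒪_{Z,ξ}` (a principal prime is not the maximal ideal in dimension two). [folklore] -/
theorem stalkIdeal_not_le_span_pow_of_nonProcrastinating {K : Type u} [Field K] [CharP K p] (A : AmbientDatum p K)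
    (E : IdealExponent A.Z) (ξ : A.Z) (hnp : ∀ η ∈ E.sing, η ⤳ ξ → η = ξ)
    (hdim : ringKrullDim (A.Z.presheaf.stalk ξ) = 2) (a : A.Z.presheaf.stalk ξ) (ha : Prime a) :
    ¬ stalkIdeal E.J ξ ≤ Ideal.span {a ^ E.b} := by
  haveI hregO : IsRegularLocalRing (A.Z.presheaf.stalk ξ) := ambient_isRegular A ξ
  haveI : (Ideal.span {a}).IsPrime := (Ideal.span_singleton_prime ha.ne_zero).mpr ha
  rw [← Ideal.span_singleton_pow]
  refine stalkIdeal_not_le_prime_pow_of_nonProcrastinating E ξ hnp (Ideal.span {a}) fun hmax => ?_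
  haveI : (Ideal.span {a} : Ideal (A.Z.presheaf.stalk ξ)).IsPrincipal := ⟨⟨a, rfl⟩⟩
  have hmin : maximalIdeal (A.Z.presheaf.stalk ξ) ∈ (Ideal.span {a} : Ideal (A.Z.presheaf.stalk ξ)).minimalPrimes := by
    rw [← hmax, Ideal.minimalPrimes_eq_subsingleton_self]
    exact Set.mem_singleton _
  have h1 := Ideal.height_le_one_of_isPrincipal_of_mem_minimalPrimes (Ideal.span {a}) _ hmin
  have h2 : ringKrullDim (A.Z.presheaf.stalk ξ) ≤ 1 := by
    rw [← IsLocalRing.maximalIdeal_height_eq_ringKrullDim]; exact_mod_cast h1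
  rw [hdim] at h2
  exact absurd h2 (by decide)

/-! ## The laws of the measure at a point blow-up (`K : Type`) -/

section PointStep

variable {K : Type} [Field K] [CharP K p]

set_option maxHeartbeats 400000 in
/-- **The root node is an ISOLATED node.** At a closed point `ξ ∈ Sing(E)` of a standard ideal exponent with
`dim 𝒪_{Z,ξ} = 2` to which no other point of `Sing(E)` specialises, `⟨(𝒪_{Z,ξ} → K(Z)).range, J_ξ⟩` is an isolated node:
regular of dimension two with fraction field `K(Z)`, `J_ξ ⊆ 𝔪^b`, `J_ξ ⊄ (q^b)` for every prime `q`, N-1 prime quotients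
(stalks of schemes of finite type over `K : Type`). [folklore] -/
theorem isIsolatedNode_range_of_nonProcrastinating (A : AmbientDatum p K) (E : IdealExponent A.Z) (ξ : A.Z)
    (hξS : ξ ∈ E.sing) (hnp : ∀ η ∈ E.sing, η ⤳ ξ → η = ξ) (hdim : ringKrullDim (A.Z.presheaf.stalk ξ) = 2) :
    haveI := ambient_isIntegral A
    IsIsolatedNode E.b (⟨(algebraMap (A.Z.presheaf.stalk ξ) A.Z.functionField).range,
      (stalkIdeal E.J ξ).map (algebraMap (A.Z.presheaf.stalk ξ) A.Z.functionField).rangeRestrict⟩ :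
        MarkedNode A.Z.functionField) := by
  haveI := ambient_isIntegral A
  haveI hregO : IsRegularLocalRing (A.Z.presheaf.stalk ξ) := ambient_isRegular A ξ
  haveI hreg : IsRegularLocalRing (algebraMap (A.Z.presheaf.stalk ξ) A.Z.functionField).range :=
    isRegularLocalRing_range_of ξ
  set ι := algebraMap (A.Z.presheaf.stalk ξ) A.Z.functionField with hι
  have hinj : Function.Injective ι := algebraMap_stalk_functionField_injective ξ
  have hbij : Function.Bijective ι.rangeRestrict := ⟨fun _ _ h => hinj (congrArg Subtype.val h), ι.rangeRestrict_surjective⟩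
  let eR : A.Z.presheaf.stalk ξ ≃+* ι.range := RingEquiv.ofBijective ι.rangeRestrict hbij
  refine ⟨⟨hreg, (ringKrullDim_range_algebraMap_stalk ξ).trans hdim, isLocalRingOf_range_algebraMap_stalk ξ, ?_⟩,
    fun q hq hle => ?_, fun P hP => ?_⟩
  · -- `I ≤ 𝔪_R^b`
    have h := Ideal.map_mono (f := ι.rangeRestrict) ((mem_sing_iff_stalkIdeal_le_pow E ξ).mp hξS)
    rw [Ideal.map_pow, map_rangeRestrict_maximalIdeal] at h
    exact h
  · -- isolation in prime-element form, pulled back along `eR`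
    obtain ⟨a, rfl⟩ := eR.surjective q
    have ha : Prime a := (MulEquiv.prime_iff eR.toMulEquiv).mp hq
    apply stalkIdeal_not_le_span_pow_of_nonProcrastinating A E ξ hnp hdim a ha
    have h := Ideal.comap_mono (f := ι.rangeRestrict) hle
    rw [Ideal.comap_map_of_bijective _ hbij] at h
    refine h.trans ?_
    rw [← map_pow, show ((eR (a ^ E.b) : ι.range)) = ι.rangeRestrict (a ^ E.b) from rfl,
      ← Set.image_singleton, ← Ideal.map_span, Ideal.comap_map_of_bijective _ hbij]
  · -- N-1 prime quotients
    haveI := hP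
    by_cases hP1 : ringKrullDim (ι.range ⧸ P) = 1
    · exact module_finite_integralClosure_quotient_range_stalk A ξ P (FractionRing (ι.range ⧸ P)) hP hP1
    · -- dimension `0` (a field) or `2` (`P = ⊥`, the ring itself is integrally closed): both N-1 trivially via the
      -- essential finite type route as well
      obtain ⟨φ, hφ⟩ := exists_essFiniteType_range_stalk A ξ
      exact module_finite_integralClosure_quotient_of_essFiniteType φ hφ P (FractionRing (ι.range ⧸ P))

/-- **THE CENTRE LAW of the measure at a point blow-up.** Let `π : Z′ → Z` be the blowing up of a closed point `ξ ∈ Sing(E)`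
of a standard ideal exponent on a surface germ (`dim 𝒪_{Z,ξ} = 2`) to which no other point of `Sing(E)` specialises, and
`E′` the transform. Then for every finset `t` of points of `Z′` over `ξ`:
`Σ_{ξ′ ∈ t} μ(A′, E′, ξ′) < μ(A, E, ξ)` with `μ = looseGermMeasure` at the stalks — the points over `ξ` with two-dimensional
local ring are distinct first quadratic transforms of `𝒪_{Z,ξ}` carrying, as normal form of the stalk of `E′`, the loose
transform (`normalForm_ctrlTransform_eq_looseTransform`); the others contribute `0`; conclude by the centre inequality of the
loose tree (`sum_looseExitCount_lt_of_isIsolatedNode`). [cite: ZariskiSamuel1960, Appendix 5] -/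
theorem looseGermMeasure_centre_lt (A A' : AmbientDatum p K) (E : IdealExponent A.Z) (ξ : A.Z)
    (hξ : IsClosed ({ξ} : Set A.Z)) (π : A'.Z ⟶ A.Z) (hξS : ξ ∈ E.sing)
    (hnp : ∀ η ∈ E.sing, η ⤳ ξ → η = ξ) (hdim : ringKrullDim (A.Z.presheaf.stalk ξ) = 2)
    (hπ : IsBlowup π (vanishingIdeal ⟨{ξ}, hξ⟩)) (t : Finset A'.Z) (ht : ∀ ξ' ∈ t, π ξ' = ξ) :
    t.sum (fun ξ' => looseGermMeasure (A'.Z.presheaf.stalk ξ') (stalkIdeal (E.transform π ⟨{ξ}, hξ⟩).J ξ') E.b) <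
      looseGermMeasure (A.Z.presheaf.stalk ξ) (stalkIdeal E.J ξ) E.b := by
  classical
  haveI := ambient_isIntegral A
  haveI := ambient_isIntegral A'
  haveI : IsLocallyNoetherian A.Z := ambient_isLocallyNoetherian A
  haveI : IsLocallyNoetherian A'.Z := ambient_isLocallyNoetherian A'
  haveI hregO : IsRegularLocalRing (A.Z.presheaf.stalk ξ) := ambient_isRegular A ξ
  set E' := E.transform π ⟨{ξ}, hξ⟩ with hE'def
  have hm : stalkIdeal (vanishingIdeal ⟨{ξ}, hξ⟩) ξ = maximalIdeal (A.Z.presheaf.stalk ξ) :=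
    stalkIdeal_vanishingIdeal_singleton (X := A.Z) hξ
  -- the root node
  set ι := algebraMap (A.Z.presheaf.stalk ξ) A.Z.functionField with hι
  set R : Subring A.Z.functionField := ι.range with hR
  set I : Ideal R := (stalkIdeal E.J ξ).map ι.rangeRestrict with hI
  haveI hregR : IsRegularLocalRing R := isRegularLocalRing_range_of ξ
  have hroot_iso : IsIsolatedNode E.b (⟨R, I⟩ : MarkedNode A.Z.functionField) :=
    isIsolatedNode_range_of_nonProcrastinating A E ξ hξS hnp hdim
  have hinj : Function.Injective ι := algebraMap_stalk_functionField_injective ξ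
  have hbijι : Function.Bijective ι.rangeRestrict :=
    ⟨fun _ _ h => hinj (congrArg Subtype.val h), ι.rangeRestrict_surjective⟩
  let eR : A.Z.presheaf.stalk ξ ≃+* R := RingEquiv.ofBijective ι.rangeRestrict hbijι
  -- the value at the root: `NF(J_ξ) = J_ξ` (isolated), read in `K(Z)`
  have hisoO : ∀ a : A.Z.presheaf.stalk ξ, Prime a → ¬ stalkIdeal E.J ξ ≤ Ideal.span {a ^ E.b} :=
    fun a ha => stalkIdeal_not_le_span_pow_of_nonProcrastinating A E ξ hnp hdim a ha
  have hroot : looseGermMeasure (A.Z.presheaf.stalk ξ) (stalkIdeal E.J ξ) E.b = looseExitCount E.b R I := by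
    rw [looseGermMeasure_eq, normalForm_eq_self_of_isolated hisoO]
    refine germLooseExitCount_eq_looseExitCount ι hinj (fun z => ?_) _ _
    obtain ⟨a, c, hc, hac⟩ := IsFractionRing.div_surjective (A := A.Z.presheaf.stalk ξ) z
    exact ⟨a, c, (map_ne_zero_iff _ hinj).mpr (nonZeroDivisors.ne_zero hc), hac.symm⟩
  -- the nodes over `ξ`
  let σ : A'.Z → Subring A.Z.functionField := fun ξ' => (hπ.stalkEmb ξ').range
  -- the points of `t` with two-dimensional stalk
  set t₂ := t.filter fun ξ' => ringKrullDim (A'.Z.presheaf.stalk ξ') = 2 with ht₂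
  have hσinj : Set.InjOn σ t₂ := fun ξ₁ h₁ ξ₂ h₂ h =>
    eq_of_range_stalkEmb_eq hπ (((ht ξ₁ (Finset.mem_filter.mp h₁).1)).trans
      ((ht ξ₂ (Finset.mem_filter.mp h₂).1)).symm) h
  have hF : ∀ S' ∈ t₂.image σ, IsQuadraticTransform R S' ∧ ringKrullDim S' = 2 := by
    intro S' hS'
    obtain ⟨ξ', hξ', rfl⟩ := Finset.mem_image.mp hS'
    obtain ⟨hξ't, hd2⟩ := Finset.mem_filter.mp hξ'
    exact ⟨isQuadraticTransform_range_stalkEmb' hπ (ht ξ' hξ't) hm, (ringKrullDim_range_stalkEmb hπ ξ').trans hd2⟩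
  -- the values at the two-dimensional nodes
  have hval : ∀ ξ' ∈ t₂, looseGermMeasure (A'.Z.presheaf.stalk ξ') (stalkIdeal E'.J ξ') E.b =
      looseExitCount E.b (σ ξ') (looseTransform E.b R I (σ ξ')) := by
    intro ξ' hξ'
    obtain ⟨hξ't, hd2⟩ := Finset.mem_filter.mp hξ'
    have hπξ' := ht ξ' hξ't
    haveI : IsRegularLocalRing (A'.Z.presheaf.stalk ξ') := ambient_isRegular A' ξ'
    haveI hregσ : IsRegularLocalRing (σ ξ') := isRegularLocalRing_range_stalkEmb hπ ξ'
    rw [looseGermMeasure_eq]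
    -- read `NF(J'_{ξ'})` in `K(Z)` through `ε_{ξ'}`
    have hfrac : ∀ z : A.Z.functionField, ∃ a c : A'.Z.presheaf.stalk ξ', hπ.stalkEmb ξ' c ≠ 0 ∧
        z = hπ.stalkEmb ξ' a / hπ.stalkEmb ξ' c := fun z => exists_frac_stalkEmb hπ ξ' z
    rw [germLooseExitCount_eq_looseExitCount (hπ.stalkEmb ξ') (hπ.stalkEmb_injective ξ') hfrac]
    -- transport the normal form along `𝒪_{Z',ξ'} ≃ ε(𝒪_{Z',ξ'})`
    have hbijε : Function.Bijective (hπ.stalkEmb ξ').rangeRestrict :=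
      ⟨fun _ _ h => hπ.stalkEmb_injective ξ' (congrArg Subtype.val h), (hπ.stalkEmb ξ').rangeRestrict_surjective⟩
    let eS : A'.Z.presheaf.stalk ξ' ≃+* (hπ.stalkEmb ξ').range := RingEquiv.ofBijective (hπ.stalkEmb ξ').rangeRestrict hbijε
    have heS : (eS : A'.Z.presheaf.stalk ξ' →+* (hπ.stalkEmb ξ').range) = (hπ.stalkEmb ξ').rangeRestrict := rfl
    have hNF : (normalForm E.b (stalkIdeal E'.J ξ')).map (hπ.stalkEmb ξ').rangeRestrict =
        normalForm E.b ((stalkIdeal E'.J ξ').map (hπ.stalkEmb ξ').rangeRestrict) := by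
      rw [← heS, map_normalForm eS]
    rw [hNF, hE'def, map_rangeRestrict_stalkIdeal_transform_eq_ctrlTransform' hπξ' hξ hπ E]
    congr 1
    exact normalForm_ctrlTransform_eq_looseTransform hroot_iso (isQuadraticTransform_range_stalkEmb' hπ hπξ' hm)
      ((ringKrullDim_range_stalkEmb hπ ξ').trans hd2)
  -- the values at the other nodes vanish
  have hzero : ∀ ξ' ∈ t, ξ' ∉ t₂ → looseGermMeasure (A'.Z.presheaf.stalk ξ') (stalkIdeal E'.J ξ') E.b = 0 := by
    intro ξ' hξ't hξ'2
    have hd2 : ringKrullDim (A'.Z.presheaf.stalk ξ') ≠ 2 := fun h => hξ'2 (Finset.mem_filter.mpr ⟨hξ't, h⟩)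
    rw [looseGermMeasure_eq]
    have hfrac : ∀ z : A.Z.functionField, ∃ a c : A'.Z.presheaf.stalk ξ', hπ.stalkEmb ξ' c ≠ 0 ∧
        z = hπ.stalkEmb ξ' a / hπ.stalkEmb ξ' c := fun z => exists_frac_stalkEmb hπ ξ' z
    rw [germLooseExitCount_eq_looseExitCount (hπ.stalkEmb ξ') (hπ.stalkEmb_injective ξ') hfrac]
    exact looseExitCount_eq_zero_of_ringKrullDim_ne_two _ (by rwa [ringKrullDim_range_stalkEmb hπ ξ'])
  -- assemble
  have hsplit : t.sum (fun ξ' => looseGermMeasure (A'.Z.presheaf.stalk ξ') (stalkIdeal E'.J ξ') E.b) =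
      t₂.sum (fun ξ' => looseGermMeasure (A'.Z.presheaf.stalk ξ') (stalkIdeal E'.J ξ') E.b) := by
    rw [ht₂, Finset.sum_filter]
    refine Finset.sum_congr rfl fun ξ' hξ' => ?_
    split_ifs with h
    · rfl
    · exact hzero ξ' hξ' (fun hm2 => h (Finset.mem_filter.mp hm2).2)
  rw [hsplit, hroot, Finset.sum_congr rfl hval]
  have key := sum_looseExitCount_lt_of_isIsolatedNode hroot_iso (t₂.image σ) hF
  rwa [Finset.sum_image hσinj] at key

/-- **THE OFF-CENTRE LAW of the measure**: along any blowing up of a closed centre `D`, at a point `ξ′` NOT over the centre,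
`μ(A′, E′, ξ′) = μ(A, E, π ξ′)` (germ-local measure, res-L1-s46-pv-9's `offCentre_eq_of_germLocal`). [folklore] -/
theorem looseGermMeasure_offCentre_eq {A A' : AmbientDatum p K} (E : IdealExponent A.Z) {D : Closeds A.Z}
    {π : A'.Z ⟶ A.Z} (hπ : IsBlowup π (vanishingIdeal D)) {ξ' : A'.Z} (hξ' : π ξ' ∉ (D : Set A.Z)) :
    looseGermMeasure (A'.Z.presheaf.stalk ξ') (stalkIdeal (E.transform π D).J ξ') (E.transform π D).b =
      looseGermMeasure (A.Z.presheaf.stalk (π ξ')) (stalkIdeal E.J (π ξ')) E.b :=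
  offCentre_eq_of_germLocal (p := p) (K := K) looseGermMeasure looseGermMeasure_map_ringEquiv
    (fun A E ξ => looseGermMeasure (A.Z.presheaf.stalk ξ) (stalkIdeal E.J ξ) E.b) (fun _ _ _ => rfl) E hπ hξ'

end PointStep

end CampaignW46

end Summit.ResolutionOfSingularities.ResolutionOfSingularities.Theorems

end
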